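import Summits.MatrixMultiplication.OmegaCensus.STPP122RankThreeCertEngine
import Summits.MatrixMultiplication.OmegaCensus.STPP122AffineWLOG
import Summits.MatrixMultiplication.OmegaCensus.STPPRoleSymmetry

/-!
# (1,2,2)³ in (ℤ/3)³ — the RANK-3 ROOM CERTIFICATE, part B — reflection 1/3 (encoding, masks, words)

Cell `pub-omega` (unit `pub-omega-stpp-1-g34`), topic `Summits/MatrixMultiplication/OmegaCensus`.
HONEST FRAMING (verbatim): lottery ticket; floor = certified bounds/negative ranges. Census STRUCTURE bookkeeping (C10 / X-38: the identified
MECHANISM at the cell (3, 27)); nothing here is a bound on `ω`.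

REFLECTION, file 1/3: the tree's product encoding `E3 = prodEnc 3 (prodEnc 3 (zmodEnc 3))` of `ℤ/3 × ℤ/3 × ℤ/3` has code arithmetic
`g3` (`E3_g`), so the engine's code operations are subtraction / addition on `V 3` (`sub_enc`, `cadd_enc`); mask and list semantics
(`mem_iff_maskOf`, `mem_diffs`); extraction of the pointwise statement from `repOK` (`repOK_extract`); the WORD CONDITION of a normal-form family
(`word`: with all `Aᵢ = {0}`, `t − u' = t' − u` forces `i = j = k`, `t = t'`, `u = u'`); what the engine's STATE lists mean for the family
(`old_S_codes`, `old_cross_codes`, …).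

References: H. Cohn, R. Kleinberg, B. Szegedy, C. Umans, FOCS 2005 (arXiv:math/0511460), Def. 5.1. Records: HOME `pub-omega-stpp-1-g34/code/rank3/`.
-/

namespace Summit.MatrixMultiplication.OmegaCensus

namespace Rank3Cert

open Finset Pointwise Literature.Computability.AlgebraicComplexity GLNF STPP211Neg

/-- The tree's product encoding of `ℤ/3 × ℤ/3 × ℤ/3` (code of `(x₁,x₂,x₃)` = `9x₁ + 3x₂ + x₃`). -/
noncomputable def E3 : GEnc (V 3) := prodEnc 3 (prodEnc 3 (zmodEnc 3))

/-- Its code arithmetic is `g3`. -/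
theorem E3_g : E3.g = g3 := rfl

/-- The code of `x`. -/
theorem E3_enc (x : V 3) : E3.enc x = x.1.val * 9 + (x.2.1.val * 3 + x.2.2.val) := rfl

/-- Codes are `< 27`. -/
theorem enc_lt (x : V 3) : E3.enc x < 27 := E3.enc_lt x

/-- `enc 0 = 0`. -/
theorem enc_zero : E3.enc (0 : V 3) = 0 := E3.enc_zero
/-- `enc e₁ = 1`. -/
theorem enc_e1 : E3.enc (e1 : V 3) = 1 := by rw [E3_enc]; rfl
/-- `enc e₂ = 3`. -/
theorem enc_e2 : E3.enc (e2 : V 3) = 3 := by rw [E3_enc]; rfl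

/-- Code subtraction is subtraction. -/
theorem sub_enc (x y : V 3) : g3.sub (E3.enc x) (E3.enc y) = E3.enc (x - y) := E3.sub_enc x y

/-- Code addition (`cadd`) is addition. -/
theorem cadd_enc (x y : V 3) : cadd g3 (E3.enc x) (E3.enc y) = E3.enc (x + y) := by
  show g3.sub (E3.enc x) (g3.neg (E3.enc y)) = _
  rw [← E3_g, E3.neg_enc, E3.sub_enc, sub_neg_eq_add]

/-- Equal codes, equal elements. -/
theorem enc_inj {x y : V 3} (h : E3.enc x = E3.enc y) : x = y := E3.enc_inj h

attribute [local irreducible] E3 g3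

/-! ### masks and lists of codes -/

/-- `bit c` has exactly the bit `c`. -/
theorem testBit_bit (c n : ℕ) : (bit c).testBit n = decide (c = n) := by
  show (Nat.shiftLeft 1 c).testBit n = _
  rw [shiftLeft_eq', Nat.one_shiftLeft, Nat.testBit_two_pow]

/-- Membership in a code list is the bit of its mask (`Rank3Cert.maskOf`). -/
theorem mem_iff_maskOf (l : List ℕ) (n : ℕ) : n ∈ l ↔ (maskOf l).testBit n = true := by
  induction l with
  | nil => simp [maskOf]
  | cons c l ih =>
      show _ ↔ (Nat.lor (bit c) (List.foldr (fun c m => Nat.lor (bit c) m) 0 l)).testBit n = true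
      rw [lor_eq, Nat.testBit_lor, Bool.or_eq_true, testBit_bit, decide_eq_true_eq]
      change _ ↔ _ ∨ (maskOf l).testBit n = true
      rw [← ih, List.mem_cons]
      constructor
      · rintro (h | h)
        · exact Or.inl h.symm
        · exact Or.inr h
      · rintro (h | h)
        · exact Or.inl h.symm
        · exact Or.inr h

/-- Members of `diffs`. -/
theorem mem_diffs {g : GC} {B C : List ℕ} {w : ℕ} : w ∈ diffs g B C ↔ ∃ b ∈ B, ∃ c ∈ C, w = g.sub b c := by
  simp only [diffs, List.mem_flatMap, List.mem_map]
  constructor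
  · rintro ⟨b, hb, c, hc, rfl⟩; exact ⟨b, hb, c, hc, rfl⟩
  · rintro ⟨b, hb, c, hc, rfl⟩; exact ⟨b, hb, c, hc, rfl⟩

/-- A mask with no set bit in common with `N` has `land … = 0`. -/
theorem beq_land_zero {M N : ℕ} (h : ∀ n, M.testBit n = true → N.testBit n = true → False) : Nat.beq (Nat.land M N) 0 = true := by
  rw [Nat.beq_eq, land_eq]
  apply Nat.eq_of_testBit_eq
  intro n
  rw [Nat.testBit_land, Nat.zero_testBit]
  cases hM : M.testBit n
  · rfl
  · cases hN : N.testBit n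
    · rfl
    · exact absurd (h n hM hN) id

/-! ### Extraction from the Boolean checks -/

/-- From `repOK`: an admissible, unguarded, `candOK` block 2 leaves at most `m` codes uncovered. -/
theorem repOK_extract {g : GC} {m : ℕ} {x : ℕ × ℕ × ℕ × ℕ} {b b' c c' : ℕ} (h : repOK g m x = true)
    (hb : b < 27) (hb' : b' < 27) (hc : c < 27) (hc' : c' < 27) (hbb : b < b') (hcc : c < c')
    (gd1 : (state g x).2.2.1.testBit b = false) (gd2 : (state g x).2.2.1.testBit b' = false)
    (gd3 : (state g x).2.2.2.1.testBit c = false) (gd4 : (state g x).2.2.2.1.testBit c' = false)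
    (hcand : candOK g (state g x) b b' c c' = true) : missing3 g x b b' c c' ≤ m := by
  have mem : ∀ {n}, n < 27 → n ∈ codes := fun hn => List.mem_range.2 hn
  have hblt1 : Nat.blt b b' = true := by rw [Nat.blt_eq]; exact hbb
  have hblt2 : Nat.blt c c' = true := by rw [Nat.blt_eq]; exact hcc
  simp only [repOK, List.all_eq_true] at h
  have h1 := h b (mem hb)
  simp only [gd1, Bool.false_or, List.all_eq_true] at h1
  have h2 := h1 b' (mem hb')
  simp only [hblt1, gd2, Bool.not_true, Bool.false_or, List.all_eq_true] at h2
  have h3 := h2 c (mem hc)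
  simp only [gd3, Bool.false_or, List.all_eq_true] at h3
  have h4 := h3 c' (mem hc')
  simp only [hblt2, gd4, hcand, Bool.not_true, Bool.false_or] at h4
  rw [Nat.ble_eq] at h4
  exact h4

/-! ### The normal-form family and the word condition -/

variable {B C : Fin 3 → Finset (V 3)}

/-- THE WORD CONDITION of an STPP family with all `Aᵢ = {0}`: `t − u' = t' − u` with `t ∈ Bᵢ`, `u' ∈ C_k`, `t' ∈ Bⱼ`, `u ∈ Cⱼ` forces
`i = j = k`, `t = t'`, `u = u'`. -/
theorem word (hS : IsSTPP (fun _ : Fin 3 => ({0} : Finset (V 3))) B C) {i j k : Fin 3} {t t' u u' : V 3}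
    (ht : t ∈ B i) (hu' : u' ∈ C k) (ht' : t' ∈ B j) (hu : u ∈ C j) (h : t - u' = t' - u) :
    i = j ∧ j = k ∧ t = t' ∧ u = u' := by
  have ht_eq : t = t' - u + u' := by rw [← h]; abel
  have h0 : ((0 : V 3) - 0) + (t' - t) + (u' - u) = 0 := by rw [ht_eq]; abel
  obtain ⟨hij, hjk, -, htt, huu⟩ :=
    hS i j k 0 (mem_singleton_self _) 0 (mem_singleton_self _) t ht t' ht' u hu u' hu' h0
  exact ⟨hij, hjk, htt, huu⟩

variable {β₁ β₂ γ₁ γ₂ δ₁ δ₂ ε₁ ε₂ : V 3}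

/-! ### What the state masks mean for the family -/

/-- The list of old `B`-codes is `[enc 0, enc e₁, enc β₁, enc β₂]`, and its members are codes of elements of `B 0 ∪ B 1`. -/
theorem old_B_codes (hB0 : B 0 = {0, e1}) (hB1 : B 1 = {β₁, β₂}) {n : ℕ} (hn : n ∈ [0, 1, E3.enc β₁, E3.enc β₂]) : ∃ i : Fin 3, i ≠ 2 ∧ ∃ t ∈ B i, n = E3.enc t := by
  simp only [List.mem_cons, List.mem_nil_iff, or_false] at hn
  rcases hn with rfl | rfl | rfl | rfl
  · exact ⟨0, by decide, 0, by rw [hB0]; simp, enc_zero.symm⟩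
  · exact ⟨0, by decide, e1, by rw [hB0]; simp, enc_e1.symm⟩
  · exact ⟨1, by decide, β₁, by rw [hB1]; simp, rfl⟩
  · exact ⟨1, by decide, β₂, by rw [hB1]; simp, rfl⟩

/-- The same for the old `C`-codes `[enc 0, enc e₂, enc γ₁, enc γ₂]`. -/
theorem old_C_codes (hC0 : C 0 = {0, e2}) (hC1 : C 1 = {γ₁, γ₂}) {n : ℕ} (hn : n ∈ [0, 3, E3.enc γ₁, E3.enc γ₂]) : ∃ k : Fin 3, k ≠ 2 ∧ ∃ u ∈ C k, n = E3.enc u := by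
  simp only [List.mem_cons, List.mem_nil_iff, or_false] at hn
  rcases hn with rfl | rfl | rfl | rfl
  · exact ⟨0, by decide, 0, by rw [hC0]; simp, enc_zero.symm⟩
  · exact ⟨0, by decide, e2, by rw [hC0]; simp, enc_e2.symm⟩
  · exact ⟨1, by decide, γ₁, by rw [hC1]; simp, rfl⟩
  · exact ⟨1, by decide, γ₂, by rw [hC1]; simp, rfl⟩

/-- Members of the old diagonal-difference list `Sl` are codes of `t − u`, `t ∈ Bⱼ`, `u ∈ Cⱼ`, `j ≠ 2`. -/
theorem old_S_codes (hB0 : B 0 = {0, e1}) (hC0 : C 0 = {0, e2}) (hB1 : B 1 = {β₁, β₂}) (hC1 : C 1 = {γ₁, γ₂}) {n : ℕ}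
    (hn : n ∈ diffs g3 [0, 1] [0, 3] ++ diffs g3 [E3.enc β₁, E3.enc β₂] [E3.enc γ₁, E3.enc γ₂]) :
    ∃ j : Fin 3, j ≠ 2 ∧ ∃ t ∈ B j, ∃ u ∈ C j, n = E3.enc (t - u) := by
  rcases (List.mem_append (a := n) (s := diffs g3 [0, 1] [0, 3]) (t := diffs g3 [E3.enc β₁, E3.enc β₂] [E3.enc γ₁, E3.enc γ₂])).1 hn with h | h
  · obtain ⟨bc, hb, cc, hc, rfl⟩ := (mem_diffs (g := g3) (B := [0, 1]) (C := [0, 3])).1 h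
    have hb' : bc ∈ [0, 1, E3.enc β₁, E3.enc β₂] := by simp only [List.mem_cons, List.mem_nil_iff, or_false] at hb ⊢; tauto
    have hc' : cc ∈ [0, 3, E3.enc γ₁, E3.enc γ₂] := by simp only [List.mem_cons, List.mem_nil_iff, or_false] at hc ⊢; tauto
    simp only [List.mem_cons, List.mem_nil_iff, or_false] at hb hc
    rcases hb with rfl | rfl <;> rcases hc with rfl | rfl
    · exact ⟨0, by decide, 0, by rw [hB0]; simp, 0, by rw [hC0]; simp, by rw [← sub_enc, enc_zero]⟩
    · exact ⟨0, by decide, 0, by rw [hB0]; simp, e2, by rw [hC0]; simp, by rw [← sub_enc, enc_zero, enc_e2]⟩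
    · exact ⟨0, by decide, e1, by rw [hB0]; simp, 0, by rw [hC0]; simp, by rw [← sub_enc, enc_zero, enc_e1]⟩
    · exact ⟨0, by decide, e1, by rw [hB0]; simp, e2, by rw [hC0]; simp, by rw [← sub_enc, enc_e1, enc_e2]⟩
  · obtain ⟨bc, hb, cc, hc, rfl⟩ := (mem_diffs (g := g3) (B := [E3.enc β₁, E3.enc β₂]) (C := [E3.enc γ₁, E3.enc γ₂])).1 h
    simp only [List.mem_cons, List.mem_nil_iff, or_false] at hb hc
    rcases hb with rfl | rfl <;> rcases hc with rfl | rfl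
    · exact ⟨1, by decide, β₁, by rw [hB1]; simp, γ₁, by rw [hC1]; simp, by rw [sub_enc]⟩
    · exact ⟨1, by decide, β₁, by rw [hB1]; simp, γ₂, by rw [hC1]; simp, by rw [sub_enc]⟩
    · exact ⟨1, by decide, β₂, by rw [hB1]; simp, γ₁, by rw [hC1]; simp, by rw [sub_enc]⟩
    · exact ⟨1, by decide, β₂, by rw [hB1]; simp, γ₂, by rw [hC1]; simp, by rw [sub_enc]⟩

/-- Members of the old cross-difference list are codes of `t − u'`, `t ∈ Bᵢ`, `u' ∈ C_k`, `i, k ≠ 2`. -/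
theorem old_cross_codes (hB0 : B 0 = {0, e1}) (hC0 : C 0 = {0, e2}) (hB1 : B 1 = {β₁, β₂}) (hC1 : C 1 = {γ₁, γ₂}) {n : ℕ}
    (hn : n ∈ diffs g3 [0, 1] [E3.enc γ₁, E3.enc γ₂] ++ diffs g3 [E3.enc β₁, E3.enc β₂] [0, 3]) :
    ∃ i k : Fin 3, i ≠ 2 ∧ k ≠ 2 ∧ ∃ t ∈ B i, ∃ u' ∈ C k, n = E3.enc (t - u') := by
  rcases (List.mem_append (a := n) (s := diffs g3 [0, 1] [E3.enc γ₁, E3.enc γ₂]) (t := diffs g3 [E3.enc β₁, E3.enc β₂] [0, 3])).1 hn with h | h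
  · obtain ⟨bc, hb, cc, hc, rfl⟩ := (mem_diffs (g := g3) (B := [0, 1]) (C := [E3.enc γ₁, E3.enc γ₂])).1 h
    obtain ⟨i, hi, t, ht, rfl⟩ := old_B_codes hB0 hB1 (n := bc) (by simp only [List.mem_cons, List.mem_nil_iff, or_false] at hb ⊢; tauto)
    obtain ⟨k, hk, u, hu, rfl⟩ := old_C_codes hC0 hC1 (n := cc) (by simp only [List.mem_cons, List.mem_nil_iff, or_false] at hc ⊢; tauto)
    exact ⟨i, k, hi, hk, t, ht, u, hu, by rw [sub_enc]⟩
  · obtain ⟨bc, hb, cc, hc, rfl⟩ := (mem_diffs (g := g3) (B := [E3.enc β₁, E3.enc β₂]) (C := [0, 3])).1 h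
    obtain ⟨i, hi, t, ht, rfl⟩ := old_B_codes hB0 hB1 (n := bc) (by simp only [List.mem_cons, List.mem_nil_iff, or_false] at hb ⊢; tauto)
    obtain ⟨k, hk, u, hu, rfl⟩ := old_C_codes hC0 hC1 (n := cc) (by simp only [List.mem_cons, List.mem_nil_iff, or_false] at hc ⊢; tauto)
    exact ⟨i, k, hi, hk, t, ht, u, hu, by rw [sub_enc]⟩

end Rank3Cert

end Summit.MatrixMultiplication.OmegaCensus
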